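import Summits.Ventures.PercRepro.Night2ThreeTwoEleven

/-!
# PercRepro — the cell `(3, 2)`: the targets of every profile are many (night-2, gen 27)

The fiber count of gen 25 (`card_fiber_ge_choose_mul_choose`) counts the GOOD targets (three points off the line) of a
basis pair of a given profile.  The small cells `9 ≤ |V| ≤ 10` are paid by the top levels of ALL the targets, so the
same count is needed without the goodness filter, along an arbitrary subset `X ⊆ V`: the targets
`T = B ∪ {z} ∪ A ∪ W` with `A ⊆ X`, `W ⊆ V ∖ X` outside `B ∪ {z}` have the profile
`(i₀ + |A|, j₀ + |W|)`, `(i₀, j₀)` the profile of `B ∪ {z}`, and they are pairwise distinct.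

* **`card_fiber_ge_choose_mul_choose_all`**: the targets of profile `(i, j)` number at least
  `C(|X| − i₀, i − i₀) · C(|V ∖ X| − j₀, j − j₀)`.
-/

namespace PercRepro.Shadow

open Finset PerFlat ThmH

variable {α : Type*} [DecidableEq α] {M : Matroid α} [M.Finite]

section FiberAll

variable {G : Finset α}

open scoped Classical in
/-- **The targets of profile `(i, j)` along `X` number at least `C(|X| − i₀, i − i₀) · C(|V ∖ X| − j₀, j − j₀)`**,
`(i₀, j₀)` the profile of the covering set `B ∪ {z}`: the sets `B ∪ {z} ∪ A ∪ W` with `A ⊆ X`, `W ⊆ V ∖ X`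
outside `B ∪ {z}`. -/
theorem card_fiber_ge_choose_mul_choose_all (hG : G ∈ flatsQ M (5 + 1)) (hd : (gr M \ G).card ≤ 5) {B : Finset α}
    (hB : B ∈ thinMembers M 5 G) {z : α} (hz : z ∈ G \ clF M B) {X : Finset α} (hXV : X ⊆ G \ coloops M G)
    {i j : ℕ} (hne : (i, j) ≠ profileAt (coloops M G) X (insert z B))
    (hi : (profileAt (coloops M G) X (insert z B)).1 ≤ i) (hj : (profileAt (coloops M G) X (insert z B)).2 ≤ j) :
    (X.card - (profileAt (coloops M G) X (insert z B)).1).choose (i - (profileAt (coloops M G) X (insert z B)).1) *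
      (((G \ coloops M G) \ X).card - (profileAt (coloops M G) X (insert z B)).2).choose
        (j - (profileAt (coloops M G) X (insert z B)).2) ≤
      ((tgtSets M 5 G B z).filter (fun T => profileAt (coloops M G) X T = (i, j))).card := by
  set K := coloops M G with hK
  set Q := insert z B with hQ
  have hB' : B ∈ membersIn M (Uq M (5 + 2) 5) G := (mem_thinMembers.1 hB).1
  have hBU : B ∈ Uq M (5 + 2) 5 := (mem_membersIn.1 hB').1
  have hBG : B ⊆ G := (subset_clF hBU).trans (mem_membersIn.1 hB').2
  have hQG : Q ⊆ G := Finset.insert_subset (Finset.mem_sdiff.1 hz).1 hBG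
  have hKB : K ⊆ B := coloops_subset_of_mem_thinMembers hG hd hB
  have hKQ : K ⊆ Q := hKB.trans (Finset.subset_insert z B)
  simp only [profileAt] at hne hi hj ⊢
  set i₀ := ((Q \ K) ∩ X).card with hi₀
  set j₀ := ((Q \ K) \ X).card with hj₀
  -- the two pools of new points
  set Aℓ := (G \ Q) ∩ X with hAℓ
  set Wℓ := (G \ Q) \ X with hWℓ
  have hAcard : Aℓ.card = X.card - i₀ := by
    have heq : Aℓ = X \ ((Q \ K) ∩ X) := by
      ext a
      simp only [hAℓ, Finset.mem_inter, Finset.mem_sdiff, not_and]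
      constructor
      · rintro ⟨⟨haG, haQ⟩, haℓ⟩
        exact ⟨haℓ, fun h => absurd h.1 haQ⟩
      · rintro ⟨haℓ, h⟩
        have haV := hXV haℓ
        rw [Finset.mem_sdiff] at haV
        refine ⟨⟨haV.1, fun haQ => ?_⟩, haℓ⟩
        exact h ⟨haQ, haV.2⟩ haℓ
    rw [heq, Finset.card_sdiff_of_subset Finset.inter_subset_right]
  have hWcard : Wℓ.card = ((G \ K) \ X).card - j₀ := by
    have heq : Wℓ = ((G \ K) \ X) \ ((Q \ K) \ X) := by
      ext a
      simp only [hWℓ, Finset.mem_sdiff, not_and, not_not]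
      constructor
      · rintro ⟨⟨haG, haQ⟩, haℓ⟩
        exact ⟨⟨⟨haG, fun haK => haQ (hKQ haK)⟩, haℓ⟩, fun h => absurd h.1 haQ⟩
      · rintro ⟨⟨⟨haG, haK⟩, haℓ⟩, h⟩
        refine ⟨⟨haG, fun haQ => ?_⟩, haℓ⟩
        exact haℓ (h ⟨haQ, haK⟩)
    rw [heq, Finset.card_sdiff_of_subset]
    intro a ha
    rw [Finset.mem_sdiff, Finset.mem_sdiff] at ha ⊢
    exact ⟨⟨hQG ha.1.1, ha.1.2⟩, ha.2⟩
  rw [← hAcard, ← hWcard, ← Finset.card_powersetCard, ← Finset.card_powersetCard, ← Finset.card_product]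
  apply Finset.card_le_card_of_injOn (fun p => Q ∪ p.1 ∪ p.2)
  · intro p hp
    rw [Finset.mem_coe, Finset.mem_product, Finset.mem_powersetCard, Finset.mem_powersetCard] at hp
    obtain ⟨⟨hA, hAc⟩, hW, hWc⟩ := hp
    rw [Finset.mem_coe, Finset.mem_filter]
    -- the profile of `T = Q ∪ A ∪ W`
    have hTK : (Q ∪ p.1 ∪ p.2) \ K = (Q \ K) ∪ p.1 ∪ p.2 := by
      ext a
      simp only [Finset.mem_sdiff, Finset.mem_union]
      constructor
      · rintro ⟨(h | h) | h, haK⟩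
        · exact Or.inl (Or.inl ⟨h, haK⟩)
        · exact Or.inl (Or.inr h)
        · exact Or.inr h
      · rintro ((⟨h, haK⟩ | h) | h)
        · exact ⟨Or.inl (Or.inl h), haK⟩
        · have := hA h
          rw [hAℓ, Finset.mem_inter, Finset.mem_sdiff] at this
          exact ⟨Or.inl (Or.inr h), fun haK => this.1.2 (hKQ haK)⟩
        · have := hW h
          rw [hWℓ, Finset.mem_sdiff, Finset.mem_sdiff] at this
          exact ⟨Or.inr h, fun haK => this.1.2 (hKQ haK)⟩
    have hAsub : p.1 ⊆ X := hA.trans Finset.inter_subset_right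
    have hAQ : Disjoint p.1 (Q \ K) := by
      rw [Finset.disjoint_left]
      intro a ha haQ
      have := hA ha
      rw [hAℓ, Finset.mem_inter, Finset.mem_sdiff] at this
      exact this.1.2 (Finset.mem_sdiff.1 haQ).1
    have hWℓ' : Disjoint p.2 X := by
      rw [Finset.disjoint_left]
      intro a ha haℓ
      have := hW ha
      rw [hWℓ, Finset.mem_sdiff] at this
      exact this.2 haℓ
    have hWQ : Disjoint p.2 (Q \ K) := by
      rw [Finset.disjoint_left]
      intro a ha haQ
      have := hW ha
      rw [hWℓ, Finset.mem_sdiff, Finset.mem_sdiff] at this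
      exact this.1.2 (Finset.mem_sdiff.1 haQ).1
    have hprof1 : (((Q ∪ p.1 ∪ p.2) \ K) ∩ X).card = i := by
      have heq : ((Q ∪ p.1 ∪ p.2) \ K) ∩ X = ((Q \ K) ∩ X) ∪ p.1 := by
        rw [hTK]
        ext a
        simp only [Finset.mem_inter, Finset.mem_union]
        constructor
        · rintro ⟨(h | h) | h, haℓ⟩
          · exact Or.inl ⟨h, haℓ⟩
          · exact Or.inr h
          · exact absurd haℓ (Finset.disjoint_left.1 hWℓ' h)
        · rintro (⟨h, haℓ⟩ | h)
          · exact ⟨Or.inl (Or.inl h), haℓ⟩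
          · exact ⟨Or.inl (Or.inr h), hAsub h⟩
      rw [heq, Finset.card_union_of_disjoint, hAc]
      · omega
      · rw [Finset.disjoint_left]
        intro a ha haA
        exact Finset.disjoint_left.1 hAQ haA (Finset.mem_inter.1 ha).1
    have hprof2 : (((Q ∪ p.1 ∪ p.2) \ K) \ X).card = j := by
      have heq : ((Q ∪ p.1 ∪ p.2) \ K) \ X = ((Q \ K) \ X) ∪ p.2 := by
        rw [hTK]
        ext a
        simp only [Finset.mem_sdiff, Finset.mem_union]
        constructor
        · rintro ⟨(h | h) | h, haℓ⟩
          · exact Or.inl ⟨h, haℓ⟩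
          · exact absurd (hAsub h) haℓ
          · exact Or.inr h
        · rintro (⟨h, haℓ⟩ | h)
          · exact ⟨Or.inl (Or.inl h), haℓ⟩
          · exact ⟨Or.inr h, Finset.disjoint_left.1 hWℓ' h⟩
      rw [heq, Finset.card_union_of_disjoint, hWc]
      · omega
      · rw [Finset.disjoint_left]
        intro a ha haW
        exact Finset.disjoint_left.1 hWQ haW (Finset.mem_sdiff.1 ha).1
    refine ⟨?_, ?_⟩
    · -- a target
      rw [mem_tgtSets]
      have hTG : Q ∪ p.1 ∪ p.2 ⊆ G :=
        Finset.union_subset (Finset.union_subset hQG (hA.trans (Finset.inter_subset_left.trans Finset.sdiff_subset)))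
          (hW.trans (Finset.sdiff_subset.trans Finset.sdiff_subset))
      have hQT : Q ⊆ Q ∪ p.1 ∪ p.2 := Finset.subset_union_left.trans Finset.subset_union_left
      refine ⟨superset_mem_shadowAt hG hB' hz hQT hTG, hQT, ?_⟩
      -- `|T ∖ B| ≥ 2`: `z` and a point of `A ∪ W`
      have hnonempty : (p.1 ∪ p.2).Nonempty := by
        by_contra hemp
        rw [Finset.not_nonempty_iff_eq_empty, Finset.union_eq_empty] at hemp
        apply hne
        rw [hemp.1, Finset.card_empty] at hAc
        rw [hemp.2, Finset.card_empty] at hWc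
        ext <;> simp only <;> omega
      obtain ⟨w, hw⟩ := hnonempty
      have hwQ : w ∉ Q := by
        rcases Finset.mem_union.1 hw with h | h
        · exact (Finset.mem_sdiff.1 (Finset.mem_inter.1 (hA h)).1).2
        · exact (Finset.mem_sdiff.1 (Finset.mem_sdiff.1 (hW h)).1).2
      have hzB : z ∉ B := notMem_of_notMem_clF hBU (Finset.mem_sdiff.1 hz).2
      have hsub : ({z, w} : Finset α) ⊆ (Q ∪ p.1 ∪ p.2) \ B := by
        intro a ha
        rw [Finset.mem_insert, Finset.mem_singleton] at ha
        rw [Finset.mem_sdiff]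
        rcases ha with rfl | rfl
        · exact ⟨hQT (Finset.mem_insert_self _ _), hzB⟩
        · refine ⟨?_, fun haB => hwQ (Finset.mem_insert_of_mem haB)⟩
          rcases Finset.mem_union.1 hw with h | h
          · exact Finset.mem_union_left _ (Finset.mem_union_right _ h)
          · exact Finset.mem_union_right _ h
      have hzw : z ≠ w := fun h => hwQ (h ▸ Finset.mem_insert_self _ _)
      have := Finset.card_le_card hsub
      rw [Finset.card_pair hzw] at this
      exact this
    · rw [hprof1, hprof2]
  · intro p hp p' hp' heq
    rw [Finset.mem_coe, Finset.mem_product, Finset.mem_powersetCard, Finset.mem_powersetCard] at hp hp'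
    simp only at heq
    -- recover `A = (T ∖ Q) ∩ X` and `W = (T ∖ Q) ∖ X`
    have key : ∀ (A W : Finset α), A ⊆ Aℓ → W ⊆ Wℓ →
        ((Q ∪ A ∪ W) \ Q) ∩ X = A ∧ ((Q ∪ A ∪ W) \ Q) \ X = W := by
      intro A W hA hW
      constructor
      · ext a
        simp only [Finset.mem_inter, Finset.mem_sdiff, Finset.mem_union]
        constructor
        · rintro ⟨⟨(h | h) | h, haQ⟩, haℓ⟩
          · exact absurd h haQ
          · exact h
          · have := hW h
            rw [hWℓ, Finset.mem_sdiff] at this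
            exact absurd haℓ this.2
        · intro h
          have := hA h
          rw [hAℓ, Finset.mem_inter, Finset.mem_sdiff] at this
          exact ⟨⟨Or.inl (Or.inr h), this.1.2⟩, this.2⟩
      · ext a
        simp only [Finset.mem_sdiff, Finset.mem_union]
        constructor
        · rintro ⟨⟨(h | h) | h, haQ⟩, haℓ⟩
          · exact absurd h haQ
          · have := hA h
            rw [hAℓ, Finset.mem_inter] at this
            exact absurd this.2 haℓ
          · exact h
        · intro h
          have := hW h
          rw [hWℓ, Finset.mem_sdiff, Finset.mem_sdiff] at this
          exact ⟨⟨Or.inr h, this.1.2⟩, this.2⟩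
    obtain ⟨e1, e2⟩ := key p.1 p.2 hp.1.1 hp.2.1
    obtain ⟨e1', e2'⟩ := key p'.1 p'.2 hp'.1.1 hp'.2.1
    rw [heq] at e1 e2
    exact Prod.ext (e1.symm.trans e1') (e2.symm.trans e2')

end FiberAll

end PercRepro.Shadow
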